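import Mathlib.Analysis.InnerProductSpace.PiL2
import Mathlib.Analysis.Matrix.Hermitian
import Mathlib.Analysis.Matrix.Order
import HarnessLib

/-!
# Two nearly orthogonal projections: the anticommutator bound of Fannes–Nachtergaele–Werner

Sibling proof file of `Literature/MathematicalPhysics/QuantumLattice/LiebRobinson.lean`
(theorem-only: no definition, no named fact), a step towards the discharge of
`fannes_nachtergaele_werner_gap` (**hubbard.S16**, the uniform spectral gap of the parent
Hamiltonian of a normal matrix product state; Fannes–Nachtergaele–Werner 1992, Thm. 6.4). It
provides the abstract two-projection lemma used in the proof of Thm. 6.4 to bound the cross terms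
of the square of the coarse-grained Hamiltonian `K = Σ_i (𝟙 - G_{2p})_{i,i+1}`:

* `posSemidef_anticommutator_add_smul` — if `G ≤ G₁`, `G ≤ G₂` are orthogonal projections and the
  ranges of `G₁ - G`, `G₂ - G` make an angle with cosine `≤ ε` (in the bilinear form
  `|⟨(G₁ - G)x, (G₂ - G)y⟩| ≤ ε ‖(G₁ - G)x‖ ‖(G₂ - G)y‖`, i.e. `‖G₁ G₂ - G‖ ≤ ε`), then
  `E F + F E + ε' (E + F) ≥ 0` for `E = 𝟙 - G₁`, `F = 𝟙 - G₂` and `ε' (1 - ε) = ε`.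

FNW's Lemma 6.3 proves (1) `‖EF - E ∧ F‖ = ‖(𝟙-E)(𝟙-F) - (𝟙-E) ∧ (𝟙-F)‖` and (2)
`EF + FE ≥ -‖EF - E ∧ F‖ (E + F)` by variational arguments, giving the constant `ε`; Theorem 6.4
only needs *some* constant tending to `0` with `ε`, and the constant `ε / (1 - ε)` has the direct
Cauchy–Schwarz proof formalised here (`two_proj_real_ineq`, `two_proj_inner_ineq`): for a vector
`v` put `v' = v - Gv`, `p = (G₁ - G)v`, `s = (G₂ - G)v`; then `Ev = v' - p`, `Fv = v' - s`,
`⟨v', p⟩ = ‖p‖²`, `⟨v', s⟩ = ‖s‖²`, `|⟨p, s⟩| ≤ ε ‖p‖ ‖s‖` and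
`(‖p‖² + ‖s‖²)² = ⟨v', p + s⟩² ≤ ‖v'‖² ‖p + s‖²`, from which
`2 re ⟨Ev, Fv⟩ + ε' (‖Ev‖² + ‖Fv‖²) ≥ 0` is elementary algebra.

## Source

* M. Fannes, B. Nachtergaele, R. F. Werner, *Finitely correlated states on quantum spin chains*,
  Comm. Math. Phys. **144** (1992) 443–490 (held: `paper:doi-10-1007-bf02099178`), §6:
  Lemma 6.3 (p. 477: "(1) `‖EF - E ∧ F‖ = ‖(𝟙-E)(𝟙-F) - (𝟙-E) ∧ (𝟙-F)‖`,
  (2) `EF + FE ≥ -‖EF - E ∧ F‖ (E + F)`") and the proof of Theorem 6.4 (p. 479: "To the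
  projections `E = (𝟙 - G_{2p})_{i,i+1}` and `F = (𝟙 - G_{2p})_{j,j+1}` with `|i - j| = 1` we apply
  successively Lemmas 6.3.(2), 6.3.(1), 5.5, and 6.2"). [FannesNachtergaeleWernerCMP1992]

Mathlib: `EuclideanSpace`, `norm_inner_le_norm`, `norm_add_sq`, `norm_sub_sq`,
`Matrix.PosSemidef.of_dotProduct_mulVec_nonneg`, `Matrix.IsHermitian.im_star_dotProduct_mulVec_self`.
-/

noncomputable section

open Matrix
open scoped ComplexOrder MatrixOrder InnerProductSpace

namespace Literature.MathematicalPhysics.QuantumLattice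

section TwoProjections

/-- The elementary real inequality behind the two-projection lemma: with `T = P² + S²`,
`|t| ≤ ε T`, `T² ≤ N (T + t)` (Cauchy–Schwarz) and `ε' (1 - ε) = ε`, one has
`(2 + ε') T - t ≤ (2 + 2ε') N`. [folklore] -/
theorem two_proj_real_ineq {ε ε' N T t : ℝ} (hε'0 : 0 ≤ ε')
    (hrel : ε' * (1 - ε) = ε) (hN0 : 0 ≤ N) (hT0 : 0 ≤ T) (ht : |t| ≤ ε * T)
    (hCS : T ^ 2 ≤ N * (T + t)) : (2 + ε') * T - t ≤ (2 + 2 * ε') * N := by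
  obtain ⟨ht1, ht2⟩ := abs_le.1 ht
  by_cases hTt : T + t ≤ 0
  · -- then `T = 0 = t` (as `ε < 1` unless `T = 0`; in all cases `(1-ε) T ≤ 0`)
    have hεT : (1 - ε) * T ≤ 0 := by nlinarith
    by_cases hε1 : ε < 1
    · have hT0' : T = 0 := by nlinarith
      have ht0 : t = 0 := by
        subst hT0'
        have h1 : t ≤ 0 := by simpa using ht2
        have h2 : 0 ≤ t := by simpa using ht1
        linarith
      rw [hT0', ht0]
      nlinarith
    · -- `ε ≥ 1`: then `ε' (1 - ε) = ε ≥ 1 > 0` forces `1 - ε > 0`, contradiction unless impossible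
      exfalso
      push Not at hε1
      have : ε' * (1 - ε) ≤ 0 := mul_nonpos_of_nonneg_of_nonpos hε'0 (by linarith)
      linarith
  · push Not at hTt
    have h1 : (2 + 2 * ε') * T ^ 2 ≤ (2 + 2 * ε') * N * (T + t) := by
      have := mul_le_mul_of_nonneg_left hCS (by positivity : (0 : ℝ) ≤ 2 + 2 * ε')
      nlinarith
    have h2 : ((2 + ε') * T - t) * (T + t) ≤ (2 + 2 * ε') * T ^ 2 := by
      have h3 : (1 + ε') * T * t ≤ (1 + ε') * T * (ε * T) :=
        mul_le_mul_of_nonneg_left ht2 (by positivity)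
      nlinarith [sq_nonneg t]
    exact le_of_mul_le_mul_right (h2.trans h1) hTt

/-- **The geometric core of the two-projection lemma** (inner-product-space form). If
`⟨v', p⟩ = ‖p‖²`, `⟨v', s⟩ = ‖s‖²` and `|⟨p, s⟩| ≤ ε ‖p‖ ‖s‖` with `ε' (1 - ε) = ε`, then
`2 re ⟨v' - p, v' - s⟩ + ε' (‖v' - p‖² + ‖v' - s‖²) ≥ 0`. (Cauchy–Schwarz gives
`(‖p‖² + ‖s‖²)² = |⟨v', p + s⟩|² ≤ ‖v'‖² ‖p + s‖²`, and the rest is `two_proj_real_ineq`.)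
Fannes–Nachtergaele–Werner (1992), proof of Lemma 6.3 / Thm. 6.4. [folklore] -/
theorem two_proj_inner_ineq {V : Type*} [NormedAddCommGroup V] [InnerProductSpace ℂ V]
    {ε ε' : ℝ} (hε0 : 0 ≤ ε) (hε'0 : 0 ≤ ε') (hrel : ε' * (1 - ε) = ε) (v' p s : V)
    (hvp : ⟪v', p⟫_ℂ = ⟪p, p⟫_ℂ) (hvs : ⟪v', s⟫_ℂ = ⟪s, s⟫_ℂ)
    (hg : ‖⟪p, s⟫_ℂ‖ ≤ ε * ‖p‖ * ‖s‖) :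
    0 ≤ 2 * (⟪v' - p, v' - s⟫_ℂ).re + ε' * (‖v' - p‖ ^ 2 + ‖v' - s‖ ^ 2) := by
  have hpp : (⟪p, p⟫_ℂ).re = ‖p‖ ^ 2 := by
    rw [← inner_self_eq_norm_sq (𝕜 := ℂ) p, RCLike.re_to_complex]
  have hss : (⟪s, s⟫_ℂ).re = ‖s‖ ^ 2 := by
    rw [← inner_self_eq_norm_sq (𝕜 := ℂ) s, RCLike.re_to_complex]
  have hvv : (⟪v', v'⟫_ℂ).re = ‖v'‖ ^ 2 := by
    rw [← inner_self_eq_norm_sq (𝕜 := ℂ) v', RCLike.re_to_complex]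
  have hvp_re : (⟪v', p⟫_ℂ).re = ‖p‖ ^ 2 := by rw [hvp, hpp]
  have hvs_re : (⟪v', s⟫_ℂ).re = ‖s‖ ^ 2 := by rw [hvs, hss]
  have hpv_re : (⟪p, v'⟫_ℂ).re = ‖p‖ ^ 2 := by
    rw [← hvp_re, ← RCLike.re_to_complex, ← RCLike.re_to_complex, inner_re_symm]
  -- the quantities
  have hre : (⟪v' - p, v' - s⟫_ℂ).re = ‖v'‖ ^ 2 - ‖p‖ ^ 2 - ‖s‖ ^ 2 + (⟪p, s⟫_ℂ).re := by
    rw [inner_sub_left, inner_sub_right, inner_sub_right, Complex.sub_re, Complex.sub_re,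
      Complex.sub_re, hvs_re, hpv_re, hvv]
    ring
  have hna : ‖v' - p‖ ^ 2 = ‖v'‖ ^ 2 - ‖p‖ ^ 2 := by
    rw [norm_sub_sq (𝕜 := ℂ), RCLike.re_to_complex, hvp_re]; ring
  have hnb : ‖v' - s‖ ^ 2 = ‖v'‖ ^ 2 - ‖s‖ ^ 2 := by
    rw [norm_sub_sq (𝕜 := ℂ), RCLike.re_to_complex, hvs_re]; ring
  -- `|t| ≤ ε (P² + S²)` with `t = 2 re ⟨p, s⟩`
  have ht : |2 * (⟪p, s⟫_ℂ).re| ≤ ε * (‖p‖ ^ 2 + ‖s‖ ^ 2) := by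
    have h1 : |(⟪p, s⟫_ℂ).re| ≤ ε * ‖p‖ * ‖s‖ := (Complex.abs_re_le_norm _).trans hg
    have h2 : 2 * ‖p‖ * ‖s‖ ≤ ‖p‖ ^ 2 + ‖s‖ ^ 2 := two_mul_le_add_sq ‖p‖ ‖s‖
    rw [abs_mul, abs_two]
    nlinarith [abs_nonneg ((⟪p, s⟫_ℂ).re), norm_nonneg p, norm_nonneg s]
  -- Cauchy–Schwarz: `(P² + S²)² ≤ N (P² + S² + t)`
  have hCS : (‖p‖ ^ 2 + ‖s‖ ^ 2) ^ 2 ≤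
      ‖v'‖ ^ 2 * (‖p‖ ^ 2 + ‖s‖ ^ 2 + 2 * (⟪p, s⟫_ℂ).re) := by
    have hin : (⟪v', p + s⟫_ℂ).re = ‖p‖ ^ 2 + ‖s‖ ^ 2 := by
      rw [inner_add_right, Complex.add_re, hvp_re, hvs_re]
    have hns : ‖p + s‖ ^ 2 = ‖p‖ ^ 2 + ‖s‖ ^ 2 + 2 * (⟪p, s⟫_ℂ).re := by
      rw [norm_add_sq (𝕜 := ℂ) p s, RCLike.re_to_complex]; ring
    have h := norm_inner_le_norm (𝕜 := ℂ) v' (p + s)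
    have h' : ‖p‖ ^ 2 + ‖s‖ ^ 2 ≤ ‖v'‖ * ‖p + s‖ := by
      rw [← hin]
      exact (Complex.re_le_norm _).trans h
    have h'' := mul_self_le_mul_self (by positivity) h'
    calc (‖p‖ ^ 2 + ‖s‖ ^ 2) ^ 2 = (‖p‖ ^ 2 + ‖s‖ ^ 2) * (‖p‖ ^ 2 + ‖s‖ ^ 2) := by ring
      _ ≤ ‖v'‖ * ‖p + s‖ * (‖v'‖ * ‖p + s‖) := h''
      _ = ‖v'‖ ^ 2 * ‖p + s‖ ^ 2 := by ring
      _ = _ := by rw [hns]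
  have key := two_proj_real_ineq hε'0 hrel (by positivity : (0 : ℝ) ≤ ‖v'‖ ^ 2)
    (by positivity : (0 : ℝ) ≤ ‖p‖ ^ 2 + ‖s‖ ^ 2) ht hCS
  rw [hre, hna, hnb]
  nlinarith

variable {n : Type*} [Fintype n]

/-- `⟨x, y⟩ = x† y` : the dot product `star x ⬝ᵥ y` is the Euclidean inner product. [folklore] -/
theorem star_dotProduct_eq_inner_toLp (x y : n → ℂ) :
    star x ⬝ᵥ y = ⟪(WithLp.toLp 2 x : EuclideanSpace ℂ n), WithLp.toLp 2 y⟫_ℂ := by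
  rw [EuclideanSpace.inner_toLp_toLp, dotProduct_comm]

/-- For a Hermitian matrix, `x† (M y) = (M x)† y`. [folklore] -/
theorem star_dotProduct_mulVec_of_isHermitian {M : Matrix n n ℂ} (hM : M.IsHermitian)
    (x y : n → ℂ) : star x ⬝ᵥ M *ᵥ y = star (M *ᵥ x) ⬝ᵥ y := by
  rw [dotProduct_mulVec, star_mulVec, hM.eq]

variable [DecidableEq n]

/-- **Two nearly orthogonal projections (Fannes–Nachtergaele–Werner 1992, Lemma 6.3, in the
form used for Thm. 6.4).** Let `G ≤ G₁`, `G ≤ G₂` be orthogonal projections (`G₁ G = G = G₂ G`)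
such that the ranges of `G₁ - G` and `G₂ - G` are at an angle bounded away from `0`:
`|⟨(G₁ - G) x, (G₂ - G) y⟩| ≤ ε ‖(G₁ - G) x‖ ‖(G₂ - G) y‖`. Then for `ε' ≥ 0` with
`ε' (1 - ε) = ε` (i.e. `ε' = ε / (1 - ε)`, `ε < 1`) the complementary projections `E = 𝟙 - G₁`,
`F = 𝟙 - G₂` satisfy the operator inequality `E F + F E + ε' (E + F) ≥ 0`.
(FNW Lemma 6.3 (2) gives the constant `‖EF - E ∧ F‖ = ‖G₁G₂ - G‖ = ε` by a variational
argument; the weaker `ε/(1-ε)`, all that Theorem 6.4 needs, has a direct proof: for a vector `v`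
put `v' = v - G v`, `p = (G₁ - G) v`, `s = (G₂ - G) v`; then `E v = v' - p`, `F v = v' - s`,
`⟨v', p⟩ = ‖p‖²`, `⟨v', s⟩ = ‖s‖²`, and `two_proj_inner_ineq` applies.)
Fannes–Nachtergaele–Werner, CMP 144 (1992), Lemma 6.3 and proof of Thm. 6.4 (pp. 477–479).
[cite: FannesNachtergaeleWernerCMP1992, Lemma 6.3] -/
theorem posSemidef_anticommutator_add_smul {G₁ G₂ G : Matrix n n ℂ}
    (hG₁ : G₁.IsHermitian) (hG₁sq : G₁ * G₁ = G₁) (hG₂ : G₂.IsHermitian) (hG₂sq : G₂ * G₂ = G₂)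
    (hG : G.IsHermitian) (hGsq : G * G = G) (hG₁G : G₁ * G = G) (hG₂G : G₂ * G = G)
    {ε ε' : ℝ} (hε0 : 0 ≤ ε) (hε'0 : 0 ≤ ε') (hrel : ε' * (1 - ε) = ε)
    (hangle : ∀ x y : n → ℂ,
      ‖star ((G₁ - G) *ᵥ x) ⬝ᵥ ((G₂ - G) *ᵥ y)‖ ≤
        ε * ‖(WithLp.toLp 2 ((G₁ - G) *ᵥ x) : EuclideanSpace ℂ n)‖ *
          ‖(WithLp.toLp 2 ((G₂ - G) *ᵥ y) : EuclideanSpace ℂ n)‖) :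
    ((1 - G₁) * (1 - G₂) + (1 - G₂) * (1 - G₁) +
      ((ε' : ℝ) : ℂ) • ((1 - G₁) + (1 - G₂))).PosSemidef := by
  -- the complementary projections
  have hE : (1 - G₁).IsHermitian := Matrix.IsHermitian.sub isHermitian_one hG₁
  have hF : (1 - G₂).IsHermitian := Matrix.IsHermitian.sub isHermitian_one hG₂
  have hEsq : (1 - G₁) * (1 - G₁) = 1 - G₁ := by
    simp [Matrix.sub_mul, Matrix.mul_sub, hG₁sq]
  have hFsq : (1 - G₂) * (1 - G₂) = 1 - G₂ := by
    simp [Matrix.sub_mul, Matrix.mul_sub, hG₂sq]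
  -- `G G₁ = G = G G₂` as well
  have hGG₁ : G * G₁ = G := by
    have h := congrArg conjTranspose hG₁G
    rwa [conjTranspose_mul, hG₁.eq, hG.eq] at h
  have hGG₂ : G * G₂ = G := by
    have h := congrArg conjTranspose hG₂G
    rwa [conjTranspose_mul, hG₂.eq, hG.eq] at h
  -- the relative projections `P = G₁ - G`, `Q = G₂ - G`
  have hP : (G₁ - G).IsHermitian := hG₁.sub hG
  have hQ : (G₂ - G).IsHermitian := hG₂.sub hG
  have hPsq : (G₁ - G) * (G₁ - G) = G₁ - G := by
    simp [Matrix.sub_mul, Matrix.mul_sub, hG₁sq, hG₁G, hGG₁, hGsq]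
  have hQsq : (G₂ - G) * (G₂ - G) = G₂ - G := by
    simp [Matrix.sub_mul, Matrix.mul_sub, hG₂sq, hG₂G, hGG₂, hGsq]
  have hGP : G * (G₁ - G) = 0 := by simp [Matrix.mul_sub, hGG₁, hGsq]
  have hGQ : G * (G₂ - G) = 0 := by simp [Matrix.mul_sub, hGG₂, hGsq]
  -- Hermitian: reduce to the real part of the quadratic form
  have hHerm : ((1 - G₁) * (1 - G₂) + (1 - G₂) * (1 - G₁) +
      ((ε' : ℝ) : ℂ) • ((1 - G₁) + (1 - G₂))).IsHermitian := by
    refine Matrix.IsHermitian.add ?_ ?_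
    · rw [IsHermitian, conjTranspose_add, conjTranspose_mul, conjTranspose_mul, hE.eq, hF.eq,
        add_comm]
    · rw [IsHermitian, conjTranspose_smul, (hE.add hF).eq, Complex.star_def, Complex.conj_ofReal]
  refine PosSemidef.of_dotProduct_mulVec_nonneg hHerm fun v => ?_
  refine Complex.nonneg_iff.2 ⟨?_, (hHerm.im_star_dotProduct_mulVec_self v).symm⟩
  -- the vectors, in `ℓ²(n)`
  let a : EuclideanSpace ℂ n := WithLp.toLp 2 ((1 - G₁) *ᵥ v)
  let b : EuclideanSpace ℂ n := WithLp.toLp 2 ((1 - G₂) *ᵥ v)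
  let v' : EuclideanSpace ℂ n := WithLp.toLp 2 (v - G *ᵥ v)
  let p : EuclideanSpace ℂ n := WithLp.toLp 2 ((G₁ - G) *ᵥ v)
  let s : EuclideanSpace ℂ n := WithLp.toLp 2 ((G₂ - G) *ᵥ v)
  -- the quadratic form in terms of `a`, `b`
  have e1 : star v ⬝ᵥ ((1 - G₁) * (1 - G₂)) *ᵥ v = ⟪a, b⟫_ℂ := by
    rw [← mulVec_mulVec, star_dotProduct_mulVec_of_isHermitian hE, star_dotProduct_eq_inner_toLp]
  have e2 : star v ⬝ᵥ ((1 - G₂) * (1 - G₁)) *ᵥ v = ⟪b, a⟫_ℂ := by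
    rw [← mulVec_mulVec, star_dotProduct_mulVec_of_isHermitian hF, star_dotProduct_eq_inner_toLp]
  have e3 : star v ⬝ᵥ (1 - G₁) *ᵥ v = ⟪a, a⟫_ℂ := by
    have h : star v ⬝ᵥ ((1 - G₁) * (1 - G₁)) *ᵥ v = ⟪a, a⟫_ℂ := by
      rw [← mulVec_mulVec, star_dotProduct_mulVec_of_isHermitian hE, star_dotProduct_eq_inner_toLp]
    rwa [hEsq] at h
  have e4 : star v ⬝ᵥ (1 - G₂) *ᵥ v = ⟪b, b⟫_ℂ := by
    have h : star v ⬝ᵥ ((1 - G₂) * (1 - G₂)) *ᵥ v = ⟪b, b⟫_ℂ := by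
      rw [← mulVec_mulVec, star_dotProduct_mulVec_of_isHermitian hF, star_dotProduct_eq_inner_toLp]
    rwa [hFsq] at h
  have hform : (star v ⬝ᵥ ((1 - G₁) * (1 - G₂) + (1 - G₂) * (1 - G₁) +
      ((ε' : ℝ) : ℂ) • ((1 - G₁) + (1 - G₂))) *ᵥ v).re =
      2 * (⟪a, b⟫_ℂ).re + ε' * (‖a‖ ^ 2 + ‖b‖ ^ 2) := by
    have hba : (⟪b, a⟫_ℂ).re = (⟪a, b⟫_ℂ).re := by
      rw [← RCLike.re_to_complex, ← RCLike.re_to_complex, inner_re_symm]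
    have haa : (⟪a, a⟫_ℂ).re = ‖a‖ ^ 2 := by
      rw [← inner_self_eq_norm_sq (𝕜 := ℂ) a, RCLike.re_to_complex]
    have hbb : (⟪b, b⟫_ℂ).re = ‖b‖ ^ 2 := by
      rw [← inner_self_eq_norm_sq (𝕜 := ℂ) b, RCLike.re_to_complex]
    rw [add_mulVec, add_mulVec, smul_mulVec, add_mulVec, dotProduct_add, dotProduct_add,
      dotProduct_smul, dotProduct_add, e1, e2, e3, e4, Complex.add_re, Complex.add_re,
      smul_eq_mul, Complex.re_ofReal_mul, Complex.add_re, hba, haa, hbb]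
    ring
  rw [hform]
  -- geometry: `a = v' - p`, `b = v' - s`
  have hav : a = v' - p := by
    show WithLp.toLp 2 ((1 - G₁) *ᵥ v) = WithLp.toLp 2 (v - G *ᵥ v) - WithLp.toLp 2 ((G₁ - G) *ᵥ v)
    rw [← WithLp.toLp_sub, sub_mulVec, sub_mulVec, Matrix.one_mulVec]
    congr 1
    abel
  have hbv : b = v' - s := by
    show WithLp.toLp 2 ((1 - G₂) *ᵥ v) = WithLp.toLp 2 (v - G *ᵥ v) - WithLp.toLp 2 ((G₂ - G) *ᵥ v)
    rw [← WithLp.toLp_sub, sub_mulVec, sub_mulVec, Matrix.one_mulVec]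
    congr 1
    abel
  -- `⟨v', p⟩ = ‖p‖²`, `⟨v', s⟩ = ‖s‖²`
  have hslice : ∀ {R : Matrix n n ℂ}, R.IsHermitian → R * R = R → G * R = 0 →
      ⟪(WithLp.toLp 2 (v - G *ᵥ v) : EuclideanSpace ℂ n), WithLp.toLp 2 (R *ᵥ v)⟫_ℂ =
        ⟪(WithLp.toLp 2 (R *ᵥ v) : EuclideanSpace ℂ n), WithLp.toLp 2 (R *ᵥ v)⟫_ℂ := by
    intro R hR hRsq hGR
    rw [← star_dotProduct_eq_inner_toLp, ← star_dotProduct_eq_inner_toLp, star_sub,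
      sub_dotProduct, ← star_dotProduct_mulVec_of_isHermitian hG v (R *ᵥ v), mulVec_mulVec, hGR,
      zero_mulVec, dotProduct_zero, sub_zero, ← star_dotProduct_mulVec_of_isHermitian hR v (R *ᵥ v),
      mulVec_mulVec, hRsq]
  have hvp : ⟪v', p⟫_ℂ = ⟪p, p⟫_ℂ := hslice hP hPsq hGP
  have hvs : ⟪v', s⟫_ℂ = ⟪s, s⟫_ℂ := hslice hQ hQsq hGQ
  -- the angle hypothesis at `x = y = v`
  have hg : ‖⟪p, s⟫_ℂ‖ ≤ ε * ‖p‖ * ‖s‖ := by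
    have h := hangle v v
    rwa [star_dotProduct_eq_inner_toLp] at h
  have key := two_proj_inner_ineq hε0 hε'0 hrel v' p s hvp hvs hg
  rwa [← hav, ← hbv] at key

end TwoProjections

end Literature.MathematicalPhysics.QuantumLattice
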